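import Summits.ResolutionOfSingularities.ResolutionOfSingularities.Theorems.FrobeniusLadderFInjectiveMacaulayficationCoactionRees
import Summits.ResolutionOfSingularities.ResolutionOfSingularities.Theorems.FrobeniusLadderFInjectiveMacaulayficationWeightedChartClause
import Mathlib.RingTheory.Localization.Away.Basic
import HarnessLib

/-!
# `A' ≅ T₀[Y, Y⁻¹]` and `T₀ ≅` the non-negative part of `L` (crux `FInjectiveMacaulayfication`, H-G2 abstract, II)

Support file for crux stmt-ResolutionOfSingularities-15315 (`FrobeniusLadder.FInjectiveMacaulayfication`,
registered skeleton v11 `86e9127b`, line `graded-engine`, §16 G4 `stub_gradedChartClause`). [OURS · L1 W4.5a]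

Second abstract half of helper H-G2 `ReesVeronese` (consumer shape: lead res-L1-w45a-lead-1,
`GradedChartClausePlan.reesVeronese`). Setting of `…CoactionRees`: `L` a commutative `k`-algebra with a Laurent
coaction `β : L →+* L[T;T⁻¹]` having counit (`hε`) and homogeneous components (`hΔ`); `T₀ ⊆ A' ⊆ L[X]` the
degree-`0` and `N`-Veronese subalgebras for `deg (ℓ Xᵐ) = deg ℓ - m`.

* `dvd_sub_of_coeff_ne_zero` — the bridge between the two descriptions of `A'`: if `ℓ` is
  `β̄`-homogeneous of degree `m̄` then every non-zero `β`-component of `ℓ` has degree `≡ m (mod N)`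
  (independence of homogeneous elements of distinct degrees);
* `exists_awayEquiv` — for a homogeneous UNIT `U` of degree `N > 0` (think `U = x̄_v^c`): a ring isomorphism
  `e : Localization.Away (X : T₀[X]) ≃+* A'` over `T₀` with `e X = C U`, i.e. `A' = T₀[C U, C U⁻¹]` with `C U`
  transcendental over `T₀` (injective: homogeneous elements of the distinct degrees `m + dN` are independent;
  surjective: every element of `A'` is the sum of its components `C ((β aₘ)ⱼ) Xᵐ`, `N ∣ j - m`, each of which is
  `(C U)^{±d} ·` an element of `T₀`). This is the input of `LaurentDescent.laurentDescent` (p470480) in G4;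
* `exists_iota` — if an `R`-subalgebra `C₀ ⊆ L` is EXACTLY the set of elements whose coaction has no negative
  degrees (`β z ∈ toLaurent (L[X])`; for the blow-up chart `R[I_N/u] ⊆ R[1/u]` this is Veronese saturation,
  sequel file), then "homogenisation" `z ↦ Σₘ zₘ Xᵐ` is a ring isomorphism `ι : C₀ ≃+* T₀` with
  `toLaurent ∘ ι = β` (inverse: `X ↦ 1`); `eq_C_mul_X_pow_of_toLaurent` reads off `ι u = C u · X^N` for `u`
  homogeneous of degree `N`.

Folklore (extended Rees algebra / `𝔾ₘ`-degeneration bookkeeping, e.g. Eisenbud, *Commutative Algebra*, §6.5;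
Goto–Watanabe 1978 Ch. 3); no definitions, no named facts.
-/

-- single-problem summit: the doubled namespace component is forced
set_option linter.dupNamespace false

noncomputable section

open scoped LaurentPolynomial Polynomial
open AddMonoidAlgebra LaurentPolynomial
open Summit.ResolutionOfSingularities.ResolutionOfSingularities.Theorems.FInjectiveMacaulayfication
open Summit.ResolutionOfSingularities.ResolutionOfSingularities.Theorems.FInjectiveMacaulayfication.LaurentCoaction
open Summit.ResolutionOfSingularities.ResolutionOfSingularities.Theorems.FInjectiveMacaulayfication.CoactionRees

namespace Summit.ResolutionOfSingularities.ResolutionOfSingularities.Theorems.FInjectiveMacaulayfication.CoactionReesAway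

variable {k L : Type} [Field k] [CommRing L] [Algebra k L] (β : L →+* L[T;T⁻¹])
  (hε : ∀ ℓ : L, LaurentPolynomial.eval₂ (RingHom.id L) 1 (β ℓ) = ℓ)
  (hΔ : ∀ (ℓ : L) (i : ℤ), β ((β ℓ).coeff i) = single i ((β ℓ).coeff i))
  (N : ℕ) (T₀ A' : Subalgebra k L[X])
  (hT₀ : ∀ q : L[X], q ∈ T₀ ↔ ∀ m : ℕ, β (q.coeff m) = single (m : ℤ) (q.coeff m))
  (hA' : ∀ q : L[X], q ∈ A' ↔ ∀ m : ℕ,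
    (mapDomainRingHom L (Int.castAddHom (ZMod N))).comp β (q.coeff m) = single (m : ZMod N) (q.coeff m))

/-! ## The bridge: `β̄`-homogeneous elements have `β`-components in one residue class -/

include hΔ in
/-- If `ℓ` is `β̄`-homogeneous of degree `m̄` (all components in degrees `≡ m`), then every non-zero
`β`-component of `ℓ` sits in a degree `≡ m (mod N)`: the components in any other residue class are homogeneous
of distinct degrees and sum to zero. [folklore] -/
theorem dvd_sub_of_coeff_ne_zero {ℓ : L} {m : ℕ}
    (h : (mapDomainRingHom L (Int.castAddHom (ZMod N))).comp β ℓ = single (m : ZMod N) ℓ)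
    {i : ℤ} (hi : (β ℓ).coeff i ≠ 0) : (N : ℤ) ∣ i - m := by
  classical
  by_contra hnd
  have hne : (m : ZMod N) ≠ (i : ZMod N) := fun h' => hnd (by
    rw [← Int.cast_natCast] at h'
    exact (ZMod.intCast_eq_intCast_iff_dvd_sub (m : ℤ) i N).mp h')
  have hsum : ∑ j ∈ (β ℓ).coeff.support with (Int.castAddHom (ZMod N)) j = (i : ZMod N), (β ℓ).coeff j = 0 := by
    rw [← coeff_mapDomain_eq_sum, ← RingHom.comp_apply, h, coeff_single, Finsupp.single_apply, if_neg hne]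
  have hmem : i ∈ (β ℓ).coeff.support.filter (fun j => (Int.castAddHom (ZMod N)) j = (i : ZMod N)) :=
    Finset.mem_filter.mpr ⟨Finsupp.mem_support_iff.mpr hi, rfl⟩
  exact hi (eq_zero_of_sum_hom_eq_zero _ (fun j => (β ℓ).coeff j) id (fun _ _ _ _ h => h)
    (fun j _ => hΔ ℓ j) hsum i hmem)

/-! ## `A' ≅ T₀[Y, Y⁻¹]` -/

include hε hΔ hT₀ hA' in
/-- **`A'` is the Laurent polynomial ring over `T₀` in the unit `C U`.** For a unit `U` of `L`, homogeneous of
degree `N > 0`, there is a ring isomorphism `e : (T₀[X])[1/X] ≃+* A'` with `e (C t) = t` on `T₀` and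
`e X = C U`. [folklore] -/
theorem exists_awayEquiv (hN : 0 < N) (U V : L) (hUV : U * V = 1) (hU : β U = single (N : ℤ) U) :
    ∃ e : Localization.Away (Polynomial.X : Polynomial T₀) ≃+* A',
      (∀ t : T₀, ((e (algebraMap (Polynomial T₀) (Localization.Away (Polynomial.X : Polynomial T₀))
        (Polynomial.C t)) : A') : L[X]) = t) ∧
      ((e (algebraMap (Polynomial T₀) (Localization.Away (Polynomial.X : Polynomial T₀))
        Polynomial.X) : A') : L[X]) = Polynomial.C U := by
  classical
  have hle : T₀ ≤ A' := le_veronese β N T₀ A' hT₀ hA'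
  have hV : β V = single (-(N : ℤ)) V := hom_of_mul_eq_one hUV hU
  have hCU : Polynomial.C U ∈ A' := C_mem_veronese β N A' hA' hU (dvd_refl _)
  have hCV : Polynomial.C V ∈ A' := C_mem_veronese β N A' hA' hV (dvd_neg.mpr (dvd_refl _))
  let x : A' := ⟨Polynomial.C U, hCU⟩
  let y : A' := ⟨Polynomial.C V, hCV⟩
  have hxy : x * y = 1 := Subtype.ext (by
    show Polynomial.C U * Polynomial.C V = 1
    rw [← map_mul, hUV, map_one])
  let i : T₀ →+* A' := (Subalgebra.inclusion hle).toRingHom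
  let g : Polynomial T₀ →+* A' := Polynomial.eval₂RingHom i x
  have hgC : ∀ t : T₀, g (Polynomial.C t) = i t := fun t => Polynomial.eval₂_C _ _
  have hgX : g Polynomial.X = x := Polynomial.eval₂_X _ _
  have hunit : IsUnit (g Polynomial.X) := by rw [hgX]; exact .of_mul_eq_one y hxy
  let e₀ : Localization.Away (Polynomial.X : Polynomial T₀) →+* A' := IsLocalization.Away.lift Polynomial.X hunit
  have he₀ : ∀ P : Polynomial T₀, e₀ (algebraMap _ _ P) = g P := fun P => IsLocalization.Away.lift_eq _ hunit P
  -- `g` is injective: homogeneous elements of the distinct degrees `m + d N` are independent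
  have hginj : ∀ P : Polynomial T₀, g P = 0 → P = 0 := by
    intro P hP
    have hval : ((g P : A') : L[X]) = ∑ d ∈ P.support, ((P.coeff d : T₀) : L[X]) * Polynomial.C (U ^ d) := by
      show ((Polynomial.eval₂ i x P : A') : L[X]) = _
      rw [Polynomial.eval₂_eq_sum, Polynomial.sum, AddSubmonoidClass.coe_finsetSum]
      refine Finset.sum_congr rfl fun d _ => ?_
      rw [Subalgebra.coe_mul, Subalgebra.coe_pow, map_pow]
      rfl
    have hcoef : ∀ m : ℕ, ∑ d ∈ P.support, ((P.coeff d : T₀) : L[X]).coeff m * U ^ d = 0 := by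
      intro m
      have h := congr_arg (fun q : L[X] => q.coeff m) hval
      simp only [hP, Subalgebra.coe_zero, Polynomial.coeff_zero, Polynomial.finsetSum_coeff,
        Polynomial.coeff_mul_C] at h
      exact h.symm
    have hzero : ∀ d ∈ P.support, ∀ m : ℕ, ((P.coeff d : T₀) : L[X]).coeff m = 0 := by
      intro d hd m
      have hdeg : ∀ d' ∈ P.support, β (((P.coeff d' : T₀) : L[X]).coeff m * U ^ d') =
          single ((m : ℤ) + (d' : ℤ) * N) (((P.coeff d' : T₀) : L[X]).coeff m * U ^ d') :=
        fun d' _ => hom_mul ((hT₀ _).mp (P.coeff d').2 m) (hom_pow hU d')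
      have hinj : Set.InjOn (fun d' : ℕ => (m : ℤ) + (d' : ℤ) * N) P.support := by
        intro a _ b _ hab
        have hN' : (N : ℤ) ≠ 0 := by exact_mod_cast hN.ne'
        have : (a : ℤ) = b := mul_right_cancel₀ hN' (by simpa using hab)
        exact_mod_cast this
      have h := eq_zero_of_sum_hom_eq_zero P.support _ _ hinj hdeg (hcoef m) d hd
      calc ((P.coeff d : T₀) : L[X]).coeff m = ((P.coeff d : T₀) : L[X]).coeff m * (U * V) ^ d := by
            rw [hUV, one_pow, mul_one]
        _ = 0 := by rw [mul_pow, ← mul_assoc, h, zero_mul]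
    refine Polynomial.ext fun d => ?_
    by_cases hd : d ∈ P.support
    · rw [Polynomial.coeff_zero]
      exact Subtype.ext (Polynomial.ext fun m => by
        rw [hzero d hd m, Subalgebra.coe_zero, Polynomial.coeff_zero])
    · rw [Polynomial.coeff_zero]
      exact Polynomial.notMem_support_iff.mp hd
  -- the image of `X⁻¹` is `C V`
  let Xinv : Localization.Away (Polynomial.X : Polynomial T₀) := IsLocalization.Away.invSelf (Polynomial.X : Polynomial T₀)
  have hw : ((e₀ Xinv : A') : L[X]) = Polynomial.C V := by
    have h1 : e₀ (algebraMap (Polynomial T₀) _ Polynomial.X) * e₀ Xinv = 1 := by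
      rw [← map_mul]
      show e₀ (algebraMap _ _ (Polynomial.X : Polynomial T₀) * IsLocalization.Away.invSelf (Polynomial.X : Polynomial T₀)) = 1
      rw [IsLocalization.Away.mul_invSelf, map_one]
    rw [he₀, hgX] at h1
    have h2 : e₀ Xinv = y := by
      calc e₀ Xinv = y * x * e₀ Xinv := by rw [mul_comm y x, hxy, one_mul]
        _ = y := by rw [mul_assoc, h1, mul_one]
    rw [h2]
  -- monomials `C ℓ X^m` with `ℓ` homogeneous of degree `≡ m (mod N)` are attained
  have key : ∀ (ℓ : L) (j : ℤ) (m : ℕ), β ℓ = single j ℓ → (N : ℤ) ∣ j - m →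
      ∃ z, ((e₀ z : A') : L[X]) = Polynomial.C ℓ * Polynomial.X ^ m := by
    intro ℓ j m hℓ hdiv
    obtain ⟨d, hd⟩ := hdiv
    rcases Int.eq_nat_or_neg d with ⟨d', rfl | rfl⟩
    · have hℓ' : β (V ^ d' * ℓ) = single (m : ℤ) (V ^ d' * ℓ) := by
        have h := hom_mul (hom_pow hV d') hℓ
        have hjm : (d' : ℤ) * -(N : ℤ) + j = m := by linarith
        rwa [hjm] at h
      refine ⟨algebraMap _ _ (Polynomial.X ^ d' *
        Polynomial.C (⟨_, C_mul_X_pow_mem_degreeZero β T₀ hT₀ hℓ'⟩ : T₀)), ?_⟩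
      rw [he₀, map_mul, map_pow, hgX, hgC, Subalgebra.coe_mul, Subalgebra.coe_pow]
      show Polynomial.C U ^ d' * (Polynomial.C (V ^ d' * ℓ) * Polynomial.X ^ m) = _
      rw [← map_pow, ← mul_assoc, ← map_mul, ← mul_assoc, ← mul_pow, hUV, one_pow, one_mul]
    · have hℓ' : β (U ^ d' * ℓ) = single (m : ℤ) (U ^ d' * ℓ) := by
        have h := hom_mul (hom_pow hU d') hℓ
        have hjm : (d' : ℤ) * (N : ℤ) + j = m := by linarith
        rwa [hjm] at h
      refine ⟨Xinv ^ d' *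
        algebraMap _ _ (Polynomial.C (⟨_, C_mul_X_pow_mem_degreeZero β T₀ hT₀ hℓ'⟩ : T₀)), ?_⟩
      rw [map_mul, map_pow, he₀, hgC, Subalgebra.coe_mul, Subalgebra.coe_pow, hw]
      show Polynomial.C V ^ d' * (Polynomial.C (U ^ d' * ℓ) * Polynomial.X ^ m) = _
      rw [← map_pow, ← mul_assoc, ← map_mul, ← mul_assoc, ← mul_pow, mul_comm V U, hUV, one_pow, one_mul]
  -- surjectivity: every `a ∈ A'` is the sum of such monomials
  have hsurj : Function.Surjective e₀ := by
    intro a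
    suffices h : (a : L[X]) ∈ (e₀.range.map (A'.val : A' →+* L[X])) by
      obtain ⟨b, ⟨z, rfl⟩, hb⟩ := Subring.mem_map.mp h
      exact ⟨z, Subtype.ext hb⟩
    have hdec : (a : L[X]) = ∑ m ∈ (a : L[X]).support, ∑ j ∈ (β ((a : L[X]).coeff m)).coeff.support,
        Polynomial.C ((β ((a : L[X]).coeff m)).coeff j) * Polynomial.X ^ m := by
      conv_lhs => rw [(a : L[X]).as_sum_support_C_mul_X_pow]
      refine Finset.sum_congr rfl fun m _ => ?_
      rw [← Finset.sum_mul, ← map_sum, sum_coeff_eq β hε]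
    rw [hdec]
    refine Subring.sum_mem _ fun m _ => Subring.sum_mem _ fun j hj => ?_
    obtain ⟨z, hz⟩ := key _ j m (hΔ _ j)
      (dvd_sub_of_coeff_ne_zero β hΔ N ((hA' _).mp a.2 m) (Finsupp.mem_support_iff.mp hj))
    exact Subring.mem_map.mpr ⟨e₀ z, ⟨z, rfl⟩, hz⟩
  have hinj : Function.Injective e₀ := by
    rw [injective_iff_map_eq_zero]
    intro z hz
    induction z using Localization.induction_on with
    | H y =>
      obtain ⟨P, s⟩ := y
      rw [Localization.mk_eq_mk'] at hz ⊢
      have h := IsLocalization.mk'_spec (Localization.Away (Polynomial.X : Polynomial T₀)) P s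
      apply_fun e₀ at h
      rw [map_mul, hz, zero_mul, he₀] at h
      rw [hginj P h.symm, IsLocalization.mk'_zero]
  refine ⟨RingEquiv.ofBijective e₀ ⟨hinj, hsurj⟩, fun t => ?_, ?_⟩
  · rw [RingEquiv.ofBijective_apply, he₀, hgC]
    rfl
  · rw [RingEquiv.ofBijective_apply, he₀, hgX]

/-! ## `T₀ ≅` the subring of `L` of elements without negative components -/

include hε hΔ hT₀ in
/-- **Homogenisation.** If `C₀ ⊆ L` consists exactly of the elements whose coaction is an honest polynomial
(no components of negative degree), then `z ↦ Σₘ zₘ Xᵐ` is a ring isomorphism `ι : C₀ ≃+* T₀` characterised by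
`toLaurent (ι z) = β z` (its inverse is evaluation at `X = 1`). [folklore] -/
theorem exists_iota {R : Type} [CommRing R] [Algebra R L] (C₀ : Subalgebra R L)
    (hC₀ : ∀ z : L, z ∈ C₀ ↔ ∃ q : L[X], Polynomial.toLaurent q = β z) :
    ∃ ι : C₀ ≃+* T₀, ∀ z : C₀, Polynomial.toLaurent ((ι z : T₀) : L[X]) = β (z : L) := by
  have hβ := injective_of_counit β hε
  have h := WeightedChartClause.exists_ringEquiv_of_image_eq C₀ T₀ β Polynomial.toLaurent hβ
    Polynomial.toLaurent_injective ?_ ?_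
  · obtain ⟨e, he⟩ := h
    exact ⟨e, fun z => he z⟩
  · intro z hz
    obtain ⟨q, hq⟩ := (hC₀ z).mp hz
    refine ⟨q, (hT₀ q).mpr fun m => ?_, hq.symm⟩
    rw [← toLaurent_coeff_natCast, hq]
    exact hΔ z m
  · intro q hq
    have h : β (∑ m ∈ q.support, q.coeff m) = Polynomial.toLaurent q := by
      rw [map_sum, toLaurent_eq_sum]
      exact Finset.sum_congr rfl fun m _ => (hT₀ q).mp hq m
    exact ⟨∑ m ∈ q.support, q.coeff m, (hC₀ _).mpr ⟨q, h.symm⟩, h⟩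

/-- Reading off `ι`: a polynomial whose `toLaurent` is the monomial `single m a` is `C a * X ^ m`. [folklore] -/
theorem eq_C_mul_X_pow_of_toLaurent (q : L[X]) (a : L) (m : ℕ)
    (h : Polynomial.toLaurent q = single (m : ℤ) a) : q = Polynomial.C a * Polynomial.X ^ m :=
  Polynomial.toLaurent_injective (by rw [h, Polynomial.toLaurent_C_mul_X_pow, single_eq_C_mul_T])

end Summit.ResolutionOfSingularities.ResolutionOfSingularities.Theorems.FInjectiveMacaulayfication.CoactionReesAway

end
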